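import Summits.Langlands.Langlands.Theses.AbelianTypeDissolution

/-!
# Route AbelianTypeDissolution — Assembly

The assembly item (stmt-Langlands-27011) of the child route `AbelianTypeDissolution` (decomp-langlands lens-2 gen 33 kit V-R′;
`--refines route-Langlands-MotivicDictionarySplit:HigherMotivicReciprocity`, thaw slot 8, the 97th cell route) for
HMR = `MotivicDictionarySplit.HigherMotivicReciprocity` (stmt-Langlands-27426):
`AbelianMotivicReciprocity → WeightOneTensorTransport → AbelianTypeIsTensorGenerated → ExoticRegularReciprocity → ExoticIrregularReciprocity →
Summit.Langlands.Langlands.Theses.MotivicDictionarySplit.HigherMotivicReciprocity`.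

This is literally the type of the route file's sorry-free deciding theorem `Summit.Langlands.Langlands.Theses.AbelianTypeDissolution.closes`
(AVR, TW1, the ATT print door, XRR, XIR ⟹ HMR). Nothing here proves `Langlands` (nor the parent piece HMR): the assembly records only that the
items of the route, taken together, imply the parent piece by name.
-/

set_option linter.dupNamespace false -- project-wide option (lakefile weak.linter.dupNamespace); `Summit.Langlands.Langlands` is the mandated namespace

namespace Summit.Langlands.Langlands.Theorems

/-- **Assembly of route AbelianTypeDissolution** (stmt-Langlands-27011):
`AbelianMotivicReciprocity → WeightOneTensorTransport → AbelianTypeIsTensorGenerated → ExoticRegularReciprocity → ExoticIrregularReciprocity →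
Summit.Langlands.Langlands.Theses.MotivicDictionarySplit.HigherMotivicReciprocity`.
Proof: unfold `Assembly` and apply the route's deciding theorem `Theses.AbelianTypeDissolution.closes`. -/
theorem abelianTypeDissolution_assembly_proof :
    Summit.Langlands.Langlands.Theses.AbelianTypeDissolution.Assembly := by
  unfold Summit.Langlands.Langlands.Theses.AbelianTypeDissolution.Assembly
  exact Summit.Langlands.Langlands.Theses.AbelianTypeDissolution.closes

end Summit.Langlands.Langlands.Theorems
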